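import Summits.KontsevichZagierPeriods.KontsevichZagierPeriods.Theorems.LinRedNormalFormHoffmanSpanInKZLeTen
import Summits.KontsevichZagierPeriods.KontsevichZagierPeriods.Theorems.LinRedNormalFormHoffmanSpanInKZEds11
import Summits.KontsevichZagierPeriods.KontsevichZagierPeriods.Theorems.LinRedNormalFormHoffmanSpanInKZEds12
import Summits.KontsevichZagierPeriods.KontsevichZagierPeriods.Theorems.LinRedNormalFormHoffmanSpanInKZEds13

/-!
# Crux `LinRedNormalForm.HoffmanSpanInKZ` (stmt-KontsevichZagierPeriods-15044), line `Sketch`: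
# the crux through weight `13` unconditionally, and the crux FROM ITS TAIL

Milestone and read-back of the skeleton `Cruxes/HoffmanSpanInKZ/Lines/Sketch.lean` (v5) at the point
where everything except its declared tail is landed (leads `…-15044-0`, `-c1`, `-c2`, `-c3`).

* `edsCertificate_of_le_thirteen`, `spanAt_of_le_thirteen` — the landed rungs assembled: the tree's
  certificates `N ≤ 6`, the tables `N = 7 … 10` (`edsCertificate_of_le_ten`), and the mod-`p`
  elimination transcripts `N = 11, 12, 13` (`stub_eds11`, `stub_eds12`, `stub_eds13`) give, through the
  spanning transfer `stub_spanTransfer`, the weight slices `SpanAt N` of the crux for every `N ≤ 13`: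
  every MZV word generator `[Δ_N, q·∏ ω_ε]` of weight `N ≤ 13` (`2^11 = 2048` admissible words in weight
  `13`) is congruent modulo `KZ.relations` to a `ℤ`-combination of Hoffman generators
  `[Δ_N, q'·ω_u]`, `u ∈ {2,3}^×`, `|u| = N` — no transcendence input, every intermediate representation
  absolutely convergent.
* `hoffmanSpanInKZ_iff_tail` — hence the crux IS its tail `∀ N ≥ 14, SpanAt N`, and
  `HoffmanSpanInKZ_of_edsTail` — the registered open stub `stub_edsTail : ∀ N ≥ 14, EdsCertificate N`
  implies the crux (the composition `HoffmanSpanInKZ_of` of the skeleton, as a theorem with its one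
  open stub as hypothesis); `edsComplete_iff_tail` — that stub is exactly what is left of the named
  statement `TwoPosets.EdsComplete` (all-weights Hoffman-completeness of finite double shuffle +
  Hoffman's relation + duality: Ihara–Kaneko–Zagier 2006, Conj. 1 / Minh–Jacob–Oussous–Petitot
  strength; verified in print for `N ≤ 20`, Kaneko–Noro–Tsurumaki 2008, and by exact rank for `N ≤ 15`
  on this item; OPEN in general). By `hoffmanSpan_eq_mzvSpace_of_hoffmanSpanInKZ`
  (`…HoffmanIndependenceRealSpanning`) any proof of the tail is, read at the value level through the
  soundness of the rules, a proof of Brown's theorem `hoffmanSpan_eq_mzvSpace` (Brown 2012, Thm 1.1).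

Sources: F. Brown, *Mixed Tate motives over ℤ*, Ann. of Math. 175 (2012), Thm 1.1; K. Ihara, M. Kaneko,
D. Zagier, Compos. Math. 142 (2006), §1; M. Kaneko, M. Noro, K. Tsurumaki, IMA Vol. Math. Appl. 148
(2008); M. E. Hoffman, J. Algebra 194 (1997); M. Kontsevich, D. Zagier, *Periods* (2001), §1.2.
-/

noncomputable section

namespace Summit.KontsevichZagierPeriods.LinRedNormalForm.HoffmanSpanInKZ

open Literature.NumberTheory.Transcendental
open Summit.KontsevichZagierPeriods.MzvKernelInKZ.Negative
open Summit.KontsevichZagierPeriods.MzvKernelInKZ.TwoPosets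
open Summit.KontsevichZagierPeriods.KontsevichZagierPeriods.Theses.LinRedNormalForm (HoffmanSpanInKZ)

/-! ## The crux through weight `13`, unconditionally -/

/-- EDS certificates through weight `13`: the rungs `N ≤ 10` and the three landed transcripts. -/
theorem edsCertificate_of_le_thirteen {N : ℕ} (h : N ≤ 13) : EdsCertificate N := by
  rcases Nat.lt_or_ge N 11 with h11 | h11
  · exact edsCertificate_of_le_ten (by omega)
  · interval_cases N
    · exact stub_eds11
    · exact stub_eds12
    · exact stub_eds13

/-- **The crux through weight `13`, unconditionally**: every MZV word generator of weight `N ≤ 13`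
is congruent modulo `KZ.relations` to a `ℤ`-combination of Hoffman generators of weight `N`. -/
theorem spanAt_of_le_thirteen {N : ℕ} (h : N ≤ 13) : SpanAt N :=
  stub_spanTransfer N (edsCertificate_of_le_thirteen h)

/-- The same, read against the crux's own binders: for `w ≤ 13` the conclusion of `HoffmanSpanInKZ`
holds for every word `ε`, coefficient `q` and representation `s`. -/
theorem hoffmanSpanInKZ_of_weight_le_thirteen {w : ℕ} (hw : w ≤ 13) (ε : Fin w → Bool) (q : ℚ)
    (s : KZ.IntegralRep w) (hd : s.domain = {t | (∀ i, 0 < t i) ∧ (∀ i, t i < 1) ∧ StrictAnti t})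
    (hi : Set.EqOn s.integrand (fun t => (q : ℝ) * ∏ i, if ε i then 1 / (1 - t i) else 1 / t i)
      s.domain) :
    ∃ m ∈ AddSubgroup.closure (hoffmanGens w), KZ.of s - m ∈ KZ.relations :=
  spanAt_of_le_thirteen hw ε q s hd hi

/-- **Registered milestone `stub_leThirteen`** of line `Sketch`: the crux holds in every weight
`≤ 13`. -/
theorem stub_leThirteen : ∀ N : ℕ, N ≤ 13 → SpanAt N := fun _ h => spanAt_of_le_thirteen h

/-! ## The crux from its tail -/

/-- **The crux is its tail**: given the landed rungs, `HoffmanSpanInKZ ↔ ∀ N ≥ 14, SpanAt N`. -/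
theorem hoffmanSpanInKZ_iff_tail : HoffmanSpanInKZ ↔ ∀ N : ℕ, 14 ≤ N → SpanAt N := by
  refine ⟨fun h N _ => hoffmanSpanInKZ_iff.mp h N, fun h => hoffmanSpanInKZ_iff.mpr fun N => ?_⟩
  rcases Nat.lt_or_ge N 14 with h14 | h14
  · exact spanAt_of_le_thirteen (by omega)
  · exact h N h14

/-- EDS certificates in every weight from the tail `N ≥ 14` and the landed rungs. -/
theorem edsCertificate_of_tail (h : ∀ N : ℕ, 14 ≤ N → EdsCertificate N) (N : ℕ) :
    EdsCertificate N := by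
  rcases Nat.lt_or_ge N 14 with h14 | h14
  · exact edsCertificate_of_le_thirteen (by omega)
  · exact h N h14

/-- What is left of `EdsComplete` (all-weights completeness of the certificate family) is exactly
the tail `N ≥ 14` — the statement of the registered stub `stub_edsTail` of line `Sketch`. -/
theorem edsComplete_iff_tail : EdsComplete ↔ ∀ N : ℕ, 14 ≤ N → EdsCertificate N :=
  ⟨fun h N _ => h N, fun h => edsCertificate_of_tail h⟩

/-- **The crux from the open stub** (the skeleton's composition `HoffmanSpanInKZ_of` with its single
open stub `stub_edsTail : ∀ N ≥ 14, EdsCertificate N` as hypothesis): EDS certificates in the weights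
`≥ 14` imply `HoffmanSpanInKZ`, weight by weight through the landed spanning transfer. -/
theorem HoffmanSpanInKZ_of_edsTail (h : ∀ N : ℕ, 14 ≤ N → EdsCertificate N) : HoffmanSpanInKZ :=
  hoffmanSpanInKZ_iff.mpr fun N => stub_spanTransfer N (edsCertificate_of_tail h N)

/-- **Registered composition `stub_cruxOfEdsTail`** of line `Sketch`: the single open stub
`stub_edsTail` implies the crux (so the item is CLOSED MODULO `∀ N ≥ 14, EdsCertificate N`). -/
theorem stub_cruxOfEdsTail : (∀ N : ℕ, 14 ≤ N → EdsCertificate N) → HoffmanSpanInKZ :=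
  HoffmanSpanInKZ_of_edsTail

end Summit.KontsevichZagierPeriods.LinRedNormalForm.HoffmanSpanInKZ
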